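import Literature.NumberTheory.Automorphic.QuaternionFiniteAdeleUnitsDecomposition
import Literature.NumberTheory.Automorphic.QuaternionFiniteAdeleLocalGlue
import Literature.NumberTheory.Automorphic.QuaternionLocalSplitTraceAdjust
import HarnessLib

/-!
# Kneser's strong approximation theorem for `ℍ[K,a,b]¹`: the closure argument

Topic `NumberTheory/Automorphic`; theorems and one auxiliary definition (`coeffBound`) only, no
named fact. Ninth companion file of `QuaternionCoordOrder` on the way from its named fact
`QuaternionAlgebra.coordOrder_heckeDoubleCoset` to Kneser's strong approximation theorem
(Vignéras, LNM 800, Ch. III §4 Thm. 4.3), formalising the **last two steps of Vignéras's proof**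
(p. 81) in the coordinate model `ℍ[𝔸_K^∞,a,b]`: granted that for every box `V` some `y_V ∈ ℍ¹` and
some unit `h_V` of `ℍ[𝔸_K^∞,a,b]` have `h_V ι(y_V) h_V⁻¹ ∈ a + box(V)` (`a = (g at w₀, 1 elsewhere)`;
this is `QuaternionNormOneConjugateNear.exists_normOne_conj_near`), the element `a` lies in the
closure `𝓐` of `ι(ℍ¹)` (`extendOne_mem_approximable_of_forall_conj`):

1. (`QuaternionFiniteAdeleUnitsDecomposition`) `h_V⁻¹ = ι(γ_V) t_V u_V` with `t_V` in a fixed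
   finite set and `u_V ∈ Ô^×`, so that `ι(γ_V⁻¹ y_V γ_V) = c_V z_V c_V⁻¹` with `c_V = t_V u_V` and
   `z_V → a` (*"`H_K^1 ∩ D̃(U) ≠ ∅`"*);
2. along the filter of shrinking boxes, `t_V` is frequently some `t`, and `(u_V, u_V⁻¹)` has a
   cluster point `(û, û')` in the compact `Ô × Ô` (`𝒪̂_K` is compact) with `û û' = û' û = 1`; by
   continuity of the product in coordinates `c a c⁻¹ ∈ 𝓐` for `c = t û` (*"il existe `d ∈ D` tel
   que `d̃(a) ∈ adh(H_K^1)`"*);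
3. `𝓐` is stable under conjugation by `ι(ℍ^×)` (`conj_mem_approximable`), and conjugating
   `c a c⁻¹` by `ι(β)` with `β ∈ ℍ^×` close to `c⁻¹` at `w₀` (density of `K` in `K_{w₀}`;
   `exists_forall_conj_near_of_near_inv`) gives elements of `𝓐` arbitrarily close to `a` (*"soit
   `(b_n)` une suite d'éléments de `H_K^×` convergeant vers la composante `v`-adique de `d⁻¹` …"*);
   as `𝓐` is closed, `a ∈ 𝓐`.

## References

* M.-F. Vignéras, *Arithmétique des algèbres de quaternions*, LNM 800 (1980), Ch. I §1
  Lemme 1.1, Ch. III §4 Thm. 4.3 (proof) [VignerasLNM800].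
-/

noncomputable section

open scoped Quaternion Pointwise WithZero Valued Topology
open NumberField IsDedekindDomain Filter TopologicalSpace

namespace Literature.NumberTheory.Automorphic

namespace QuaternionAlgebra

/-! ### The norm form: multiplicativity, conjugation, units -/

section NormForm

variable {F : Type*} [CommRing F] {c₁ c₃ : F}

/-- The norm form `q₀² - c₁ q₁² - c₃ q₂² + c₁ c₃ q₃²` of `ℍ[F,c₁,c₃]` is multiplicative (Euler's
four-square identity; Vignéras I §1 Lemme 1.1: `n(hh') = n(h) n(h')`). [cite: VignerasLNM800, Ch. I §1 Lemme 1.1] -/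
theorem normForm_mul (p q : ℍ[F,c₁,c₃]) :
    (p * q).re ^ 2 - c₁ * (p * q).imI ^ 2 - c₃ * (p * q).imJ ^ 2 + c₁ * c₃ * (p * q).imK ^ 2 =
      (p.re ^ 2 - c₁ * p.imI ^ 2 - c₃ * p.imJ ^ 2 + c₁ * c₃ * p.imK ^ 2) *
        (q.re ^ 2 - c₁ * q.imI ^ 2 - c₃ * q.imJ ^ 2 + c₁ * c₃ * q.imK ^ 2) := by
  simp only [_root_.QuaternionAlgebra.re_mul, _root_.QuaternionAlgebra.imI_mul,
    _root_.QuaternionAlgebra.imJ_mul, _root_.QuaternionAlgebra.imK_mul, zero_mul, add_zero]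
  ring

/-- The norm form of `1` is `1`. [folklore] -/
theorem normForm_one :
    (1 : ℍ[F,c₁,c₃]).re ^ 2 - c₁ * (1 : ℍ[F,c₁,c₃]).imI ^ 2 - c₃ * (1 : ℍ[F,c₁,c₃]).imJ ^ 2 +
      c₁ * c₃ * (1 : ℍ[F,c₁,c₃]).imK ^ 2 = 1 := by
  simp

/-- Norm one is preserved under conjugation by a unit. [cite: VignerasLNM800, Ch. I §1 Lemme 1.1] -/
theorem conj_mul_star_eq_one (k : (ℍ[F,c₁,c₃])ˣ) {x : ℍ[F,c₁,c₃]} (hx : x * star x = 1) :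
    ((k : ℍ[F,c₁,c₃]) * x * ((k⁻¹ : (ℍ[F,c₁,c₃])ˣ) : ℍ[F,c₁,c₃])) *
      star ((k : ℍ[F,c₁,c₃]) * x * ((k⁻¹ : (ℍ[F,c₁,c₃])ˣ) : ℍ[F,c₁,c₃])) = 1 := by
  rw [mul_star_eq_one_iff_coords] at hx ⊢
  rw [normForm_mul, normForm_mul, hx, mul_one, ← normForm_mul, Units.mul_inv, normForm_one]

/-- An element with a right inverse has non-zero norm form (over a nontrivial ring). [folklore] -/
theorem normForm_ne_zero_of_mul_eq_one [Nontrivial F] {q q' : ℍ[F,c₁,c₃]} (h : q * q' = 1) :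
    q.re ^ 2 - c₁ * q.imI ^ 2 - c₃ * q.imJ ^ 2 + c₁ * c₃ * q.imK ^ 2 ≠ 0 := by
  intro h0
  have h1 := normForm_mul q q'
  rw [h, h0, zero_mul, normForm_one] at h1
  exact one_ne_zero h1

end NormForm

section Local

variable (K : Type) [Field K] [NumberField K] (v : HeightOneSpectrum (𝓞 K))

/-- `K_v`. -/
local notation "Kᵥ" => HeightOneSpectrum.adicCompletion K v

/-- A bound for the structure constants: `C(α,β) = max(1, |α|, |β|, |α||β|)`. [folklore] -/
def coeffBound (α β : Kᵥ) : ℤᵐ⁰ :=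
  max 1 (max (Valued.v α) (max (Valued.v β) (Valued.v α * Valued.v β)))

variable {K v}

/-- `1 ≤ C(α,β)`. [folklore] -/
theorem one_le_coeffBound (α β : Kᵥ) : 1 ≤ coeffBound K v α β := le_max_left _ _

/-- `C(α,β) ≠ 0`. [folklore] -/
theorem coeffBound_ne_zero (α β : Kᵥ) : coeffBound K v α β ≠ 0 :=
  (lt_of_lt_of_le zero_lt_one (one_le_coeffBound α β)).ne'

/-- **Coordinates of a product**: if the coordinates of `x` and `y` have valuations `≤ X` and
`≤ Y`, those of `x y` have valuations `≤ C(α,β) X Y` (the coordinates of `xy` are bilinear in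
those of `x, y` with coefficients `±1, ±α, ±β, ±αβ`; ultrametric inequality). [folklore] -/
theorem valued_mul_le {α β : Kᵥ} (x y : ℍ[Kᵥ,α,β]) {X Y : ℤᵐ⁰}
    (hx : Valued.v x.re ≤ X ∧ Valued.v x.imI ≤ X ∧ Valued.v x.imJ ≤ X ∧ Valued.v x.imK ≤ X)
    (hy : Valued.v y.re ≤ Y ∧ Valued.v y.imI ≤ Y ∧ Valued.v y.imJ ≤ Y ∧ Valued.v y.imK ≤ Y) :
    Valued.v (x * y).re ≤ coeffBound K v α β * X * Y ∧
    Valued.v (x * y).imI ≤ coeffBound K v α β * X * Y ∧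
    Valued.v (x * y).imJ ≤ coeffBound K v α β * X * Y ∧
    Valued.v (x * y).imK ≤ coeffBound K v α β * X * Y := by
  obtain ⟨hx₀, hx₁, hx₂, hx₃⟩ := hx
  obtain ⟨hy₀, hy₁, hy₂, hy₃⟩ := hy
  set C := coeffBound K v α β with hC
  have hC1 : Valued.v (1 : Kᵥ) ≤ C := by rw [map_one]; exact one_le_coeffBound α β
  have hCα : Valued.v α ≤ C := (le_max_left _ _).trans (le_max_right _ _)
  have hCβ : Valued.v β ≤ C := ((le_max_left _ _).trans (le_max_right _ _)).trans (le_max_right _ _)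
  have hCαβ : Valued.v (α * β) ≤ C := by
    rw [map_mul]
    exact ((le_max_right _ _).trans (le_max_right _ _)).trans (le_max_right _ _)
  -- generic term bound
  have ht : ∀ {c p q : Kᵥ}, Valued.v c ≤ C → Valued.v p ≤ X → Valued.v q ≤ Y →
      Valued.v (c * p * q) ≤ C * X * Y := fun hc hp hq => by
    rw [map_mul, map_mul]
    exact mul_le_mul' (mul_le_mul' hc hp) hq
  have ht1 : ∀ {p q : Kᵥ}, Valued.v p ≤ X → Valued.v q ≤ Y → Valued.v (p * q) ≤ C * X * Y :=
    fun hp hq => by simpa only [one_mul] using ht hC1 hp hq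
  have f₀ : (x * y).re = x.re * y.re + α * x.imI * y.imI + β * x.imJ * y.imJ -
      α * β * x.imK * y.imK := by
    rw [_root_.QuaternionAlgebra.re_mul]; ring
  have f₁ : (x * y).imI = x.re * y.imI + x.imI * y.re - β * x.imJ * y.imK + β * x.imK * y.imJ := by
    rw [_root_.QuaternionAlgebra.imI_mul]; ring
  have f₂ : (x * y).imJ = x.re * y.imJ + α * x.imI * y.imK + x.imJ * y.re - α * x.imK * y.imI := by
    rw [_root_.QuaternionAlgebra.imJ_mul]; ring
  have f₃ : (x * y).imK = x.re * y.imK + x.imI * y.imJ - x.imJ * y.imI + x.imK * y.re := by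
    rw [_root_.QuaternionAlgebra.imK_mul]; ring
  refine ⟨?_, ?_, ?_, ?_⟩
  · rw [f₀]
    exact Valuation.map_sub_le _ (Valuation.map_add_le _ (Valuation.map_add_le _ (ht1 hx₀ hy₀)
      (ht hCα hx₁ hy₁)) (ht hCβ hx₂ hy₂)) (ht hCαβ hx₃ hy₃)
  · rw [f₁]
    exact Valuation.map_add_le _ (Valuation.map_sub_le _ (Valuation.map_add_le _ (ht1 hx₀ hy₁)
      (ht1 hx₁ hy₀)) (ht hCβ hx₂ hy₃)) (ht hCβ hx₃ hy₂)
  · rw [f₂]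
    exact Valuation.map_sub_le _ (Valuation.map_add_le _ (Valuation.map_add_le _ (ht1 hx₀ hy₂)
      (ht hCα hx₁ hy₃)) (ht1 hx₂ hy₀)) (ht hCα hx₃ hy₁)
  · rw [f₃]
    exact Valuation.map_add_le _ (Valuation.map_sub_le _ (Valuation.map_add_le _ (ht1 hx₀ hy₃)
      (ht1 hx₁ hy₂)) (ht1 hx₂ hy₁)) (ht1 hx₃ hy₀)

/-- Coordinates of the norm form: `|n(ε)| ≤ C(α,β) E²` if all `|εᵢ| ≤ E`. [folklore] -/
theorem valued_normForm_le {α β : Kᵥ} (ε : ℍ[Kᵥ,α,β]) {E : ℤᵐ⁰}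
    (hε : Valued.v ε.re ≤ E ∧ Valued.v ε.imI ≤ E ∧ Valued.v ε.imJ ≤ E ∧ Valued.v ε.imK ≤ E) :
    Valued.v (ε.re ^ 2 - α * ε.imI ^ 2 - β * ε.imJ ^ 2 + α * β * ε.imK ^ 2) ≤
      coeffBound K v α β * E * E := by
  obtain ⟨h₀, h₁, h₂, h₃⟩ := hε
  set C := coeffBound K v α β with hC
  have hC1 : (1 : ℤᵐ⁰) ≤ C := one_le_coeffBound α β
  have hCα : Valued.v α ≤ C := (le_max_left _ _).trans (le_max_right _ _)
  have hCβ : Valued.v β ≤ C := ((le_max_left _ _).trans (le_max_right _ _)).trans (le_max_right _ _)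
  have hCαβ : Valued.v (α * β) ≤ C := by
    rw [map_mul]
    exact ((le_max_right _ _).trans (le_max_right _ _)).trans (le_max_right _ _)
  have ht : ∀ {c p : Kᵥ}, Valued.v c ≤ C → Valued.v p ≤ E → Valued.v (c * p ^ 2) ≤ C * E * E :=
    fun hc hp => by
      rw [map_mul, map_pow, pow_two, ← mul_assoc]
      exact mul_le_mul' (mul_le_mul' hc hp) hp
  have ht1 : Valued.v (ε.re ^ 2) ≤ C * E * E := by
    simpa only [one_mul] using ht (c := 1) (by rw [map_one]; exact hC1) h₀
  exact Valuation.map_add_le _ (Valuation.map_sub_le _ (Valuation.map_sub_le _ ht1 (ht hCα h₁))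
    (ht hCβ h₂)) (ht hCαβ h₃)

/-- **Conjugating by an approximate inverse.** Let `c c' = c' c = 1` in `ℍ[K_v,α,β]`, `g` any
element and `r ≠ 0`. There is `ρ ≠ 0` such that every `b'` whose coordinates are within `ρ` of
those of `c' = c⁻¹` is a unit, and `b' c g c' b'⁻¹` has all coordinates within `r` of those of `g`:
with `m = b' c = 1 + ε`, `ε = (b' - c') c` small, `n(m) ∈ 1 + 𝔪_v` so `m` is a unit with inverse
`w = n(m)⁻¹ m̄` of integral coordinates, `b'⁻¹ = c w`, and `b' c g c' b'⁻¹ - g = (εg - gε) w`.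
(The last step of Vignéras's proof of Thm. III.4.3: `b_n → d_v⁻¹` forces `b_n d a d⁻¹ b_n⁻¹ → a`
at `v`.) [cite: VignerasLNM800, Ch. III §4 (proof of Thm. 4.3)] -/
theorem exists_forall_conj_near_of_near_inv {α β : Kᵥ} (c c' g : ℍ[Kᵥ,α,β])
    (hcc' : c * c' = 1) (hc'c : c' * c = 1) {r : ℤᵐ⁰} (hr : r ≠ 0) :
    ∃ ρ : ℤᵐ⁰, ρ ≠ 0 ∧ ∀ b' : ℍ[Kᵥ,α,β],
      Valued.v (b' - c').re ≤ ρ → Valued.v (b' - c').imI ≤ ρ → Valued.v (b' - c').imJ ≤ ρ →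
      Valued.v (b' - c').imK ≤ ρ →
      ∃ u : (ℍ[Kᵥ,α,β])ˣ, (u : ℍ[Kᵥ,α,β]) = b' ∧
        Valued.v ((u : ℍ[Kᵥ,α,β]) * c * g * c' * ((u⁻¹ : (ℍ[Kᵥ,α,β])ˣ) : ℍ[Kᵥ,α,β]) - g).re ≤ r ∧
        Valued.v ((u : ℍ[Kᵥ,α,β]) * c * g * c' * ((u⁻¹ : (ℍ[Kᵥ,α,β])ˣ) : ℍ[Kᵥ,α,β]) - g).imI ≤ r ∧
        Valued.v ((u : ℍ[Kᵥ,α,β]) * c * g * c' * ((u⁻¹ : (ℍ[Kᵥ,α,β])ˣ) : ℍ[Kᵥ,α,β]) - g).imJ ≤ r ∧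
        Valued.v ((u : ℍ[Kᵥ,α,β]) * c * g * c' * ((u⁻¹ : (ℍ[Kᵥ,α,β])ˣ) : ℍ[Kᵥ,α,β]) - g).imK ≤ r := by
  haveI : CharZero Kᵥ := charZero_of_injective_algebraMap (algebraMap K Kᵥ).injective
  -- bounds `M ≥ 1` for the coordinates of `c` and `g`, `C = C(α,β)`
  set M : ℤᵐ⁰ := max 1 (max (max (max (Valued.v c.re) (Valued.v c.imI))
    (max (Valued.v c.imJ) (Valued.v c.imK)))
    (max (max (Valued.v g.re) (Valued.v g.imI)) (max (Valued.v g.imJ) (Valued.v g.imK)))) with hM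
  have hM1 : (1 : ℤᵐ⁰) ≤ M := le_max_left _ _
  have hM0 : M ≠ 0 := (lt_of_lt_of_le zero_lt_one hM1).ne'
  have hcM : Valued.v c.re ≤ M ∧ Valued.v c.imI ≤ M ∧ Valued.v c.imJ ≤ M ∧ Valued.v c.imK ≤ M := by
    refine ⟨?_, ?_, ?_, ?_⟩ <;> rw [hM] <;>
      [exact ((le_max_left _ _).trans (le_max_left _ _)).trans ((le_max_left _ _).trans (le_max_right _ _));
       exact ((le_max_right _ _).trans (le_max_left _ _)).trans ((le_max_left _ _).trans (le_max_right _ _));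
       exact ((le_max_left _ _).trans (le_max_right _ _)).trans ((le_max_left _ _).trans (le_max_right _ _));
       exact ((le_max_right _ _).trans (le_max_right _ _)).trans ((le_max_left _ _).trans (le_max_right _ _))]
  have hgM : Valued.v g.re ≤ M ∧ Valued.v g.imI ≤ M ∧ Valued.v g.imJ ≤ M ∧ Valued.v g.imK ≤ M := by
    refine ⟨?_, ?_, ?_, ?_⟩ <;> rw [hM] <;>
      [exact ((le_max_left _ _).trans (le_max_left _ _)).trans ((le_max_right _ _).trans (le_max_right _ _));
       exact ((le_max_right _ _).trans (le_max_left _ _)).trans ((le_max_right _ _).trans (le_max_right _ _));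
       exact ((le_max_left _ _).trans (le_max_right _ _)).trans ((le_max_right _ _).trans (le_max_right _ _));
       exact ((le_max_right _ _).trans (le_max_right _ _)).trans ((le_max_right _ _).trans (le_max_right _ _))]
  set C := coeffBound K v α β with hC
  have hC1 : (1 : ℤᵐ⁰) ≤ C := one_le_coeffBound α β
  have hC0 : C ≠ 0 := coeffBound_ne_zero α β
  -- the size `E` of `ε`, and the radius `ρ`
  have hB0 : min C⁻¹ (r * (C * C * M)⁻¹) ≠ 0 :=
    (lt_min (zero_lt_iff.mpr (inv_ne_zero hC0)) (zero_lt_iff.mpr (mul_ne_zero hr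
      (inv_ne_zero (mul_ne_zero (mul_ne_zero hC0 hC0) hM0))))).ne'
  obtain ⟨η, hη0, hη⟩ := exists_ne_zero_valued_lt K v hB0
  set E : ℤᵐ⁰ := Valued.v η with hE
  have hE0 : E ≠ 0 := (Valuation.ne_zero_iff _).mpr hη0
  have hEC : E < C⁻¹ := lt_of_lt_of_le hη (min_le_left _ _)
  have hEr : E ≤ r * (C * C * M)⁻¹ := (lt_of_lt_of_le hη (min_le_right _ _)).le
  have hCE : C * E < 1 := by
    calc C * E < C * C⁻¹ := mul_lt_mul_of_pos_left hEC (zero_lt_iff.mpr hC0)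
      _ = 1 := mul_inv_cancel₀ hC0
  have hE1 : E < 1 := lt_of_le_of_lt (le_mul_of_one_le_left' hC1) hCE
  have hCEE : C * E * E ≤ E := by
    calc C * E * E ≤ 1 * E := mul_le_mul' hCE.le le_rfl
      _ = E := one_mul E
  refine ⟨E * (C * M)⁻¹, mul_ne_zero hE0 (inv_ne_zero (mul_ne_zero hC0 hM0)), fun b' h₀ h₁ h₂ h₃ => ?_⟩
  have hρ : C * (E * (C * M)⁻¹) * M = E := by
    calc C * (E * (C * M)⁻¹) * M = E * ((C * M) * (C * M)⁻¹) := by ac_rfl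
      _ = E := by rw [mul_inv_cancel₀ (mul_ne_zero hC0 hM0), mul_one]
  -- `m = b' c = 1 + ε`, `ε = (b' - c') c`
  set m : ℍ[Kᵥ,α,β] := b' * c with hm
  set ε : ℍ[Kᵥ,α,β] := m - 1 with hεdef
  have hε : ε = (b' - c') * c := by rw [hεdef, hm, sub_mul, hc'c]
  have hεE : Valued.v ε.re ≤ E ∧ Valued.v ε.imI ≤ E ∧ Valued.v ε.imJ ≤ E ∧ Valued.v ε.imK ≤ E := by
    rw [hε, ← hρ]
    exact valued_mul_le _ _ ⟨h₀, h₁, h₂, h₃⟩ hcM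
  have hm1 : m = 1 + ε := by rw [hεdef]; abel
  -- the norm of `m` is a unit: `|n(m) - 1| < 1`
  set N : Kᵥ := m.re ^ 2 - α * m.imI ^ 2 - β * m.imJ ^ 2 + α * β * m.imK ^ 2 with hN
  have hN1 : N - 1 = 2 * ε.re + (ε.re ^ 2 - α * ε.imI ^ 2 - β * ε.imJ ^ 2 + α * β * ε.imK ^ 2) := by
    rw [hN, hm1]
    simp only [_root_.QuaternionAlgebra.re_add, _root_.QuaternionAlgebra.imI_add,
      _root_.QuaternionAlgebra.imJ_add, _root_.QuaternionAlgebra.imK_add,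
      _root_.QuaternionAlgebra.re_one, _root_.QuaternionAlgebra.imI_one,
      _root_.QuaternionAlgebra.imJ_one, _root_.QuaternionAlgebra.imK_one, zero_add]
    ring
  have hv2 : Valued.v (2 : Kᵥ) ≤ 1 := (2 : 𝒪[Kᵥ]).2
  have hvN1 : Valued.v (N - 1) < 1 := by
    rw [hN1]
    refine lt_of_le_of_lt (Valuation.map_add_le _ ?_ ((valued_normForm_le ε hεE).trans hCEE)) hE1
    rw [map_mul]
    calc Valued.v (2 : Kᵥ) * Valued.v ε.re ≤ 1 * E := mul_le_mul' hv2 hεE.1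
      _ = E := one_mul E
  have hvN : Valued.v N = 1 := by
    have e : N = 1 + (N - 1) := by ring
    have h1 : Valued.v (N - 1) < Valued.v (1 : Kᵥ) := by rw [map_one]; exact hvN1
    rw [e, Valuation.map_add_eq_of_lt_left _ h1, map_one]
  have hN0 : N ≠ 0 := (Valuation.ne_zero_iff _).mp (by rw [hvN]; exact one_ne_zero)
  -- the inverse `w = n(m)⁻¹ m̄` of `m`
  set w : ℍ[Kᵥ,α,β] := N⁻¹ • star m with hw
  have hmw : m * w = 1 := by
    rw [hw, mul_smul_comm, self_mul_star_eq_algebraMap, ← hN, Algebra.smul_def, ← map_mul,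
      inv_mul_cancel₀ hN0, map_one]
  have hwm : w * m = 1 := by
    rw [hw, smul_mul_assoc, star_comm_self', self_mul_star_eq_algebraMap, ← hN, Algebra.smul_def,
      ← map_mul, inv_mul_cancel₀ hN0, map_one]
  -- `b'` is a unit with inverse `c w`
  have h1 : b' * (c * w) = 1 := by rw [← mul_assoc, ← hm, hmw]
  have h2 : c * w * b' = 1 := by
    calc c * w * b' = c * w * b' * (c * c') := by rw [hcc', mul_one]
      _ = c * (w * (b' * c)) * c' := by simp only [mul_assoc]
      _ = 1 := by rw [← hm, hwm, mul_one, hcc']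
  refine ⟨⟨b', c * w, h1, h2⟩, rfl, ?_⟩
  -- the conjugate is `m g w`, and `m g w - g = (ε g - g ε) w`
  have hconj : b' * c * g * c' * (c * w) - g = (ε * g - g * ε) * w := by
    have e1 : b' * c * g * c' * (c * w) = m * g * w := by
      rw [hm]
      calc b' * c * g * c' * (c * w) = b' * c * g * (c' * c) * w := by simp only [mul_assoc]
        _ = b' * c * g * w := by rw [hc'c, mul_one]
    rw [e1, hm1]
    calc (1 + ε) * g * w - g = (1 + ε) * g * w - g * ((1 + ε) * w) := by
          rw [← hm1, hmw, mul_one]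
      _ = (ε * g - g * ε) * w := by noncomm_ring
  change Valued.v (b' * c * g * c' * (c * w) - g).re ≤ r ∧
    Valued.v (b' * c * g * c' * (c * w) - g).imI ≤ r ∧
    Valued.v (b' * c * g * c' * (c * w) - g).imJ ≤ r ∧
    Valued.v (b' * c * g * c' * (c * w) - g).imK ≤ r
  rw [hconj]
  -- bounds: `|εg - gε|ᵢ ≤ C E M`, `|wᵢ| ≤ 1`
  have hεg := valued_mul_le ε g hεE hgM
  have hgε := valued_mul_le g ε hgM hεE
  have hcomm : C * M * E = C * E * M := by ac_rfl
  rw [hcomm] at hgε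
  have hdiff : Valued.v (ε * g - g * ε).re ≤ C * E * M ∧ Valued.v (ε * g - g * ε).imI ≤ C * E * M ∧
      Valued.v (ε * g - g * ε).imJ ≤ C * E * M ∧ Valued.v (ε * g - g * ε).imK ≤ C * E * M := by
    simp only [_root_.QuaternionAlgebra.re_sub, _root_.QuaternionAlgebra.imI_sub,
      _root_.QuaternionAlgebra.imJ_sub, _root_.QuaternionAlgebra.imK_sub]
    exact ⟨Valuation.map_sub_le _ hεg.1 hgε.1, Valuation.map_sub_le _ hεg.2.1 hgε.2.1,
      Valuation.map_sub_le _ hεg.2.2.1 hgε.2.2.1, Valuation.map_sub_le _ hεg.2.2.2 hgε.2.2.2⟩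
  have hvNinv : Valued.v N⁻¹ = 1 := by rw [map_inv₀, hvN, inv_one]
  have hw1 : Valued.v w.re ≤ 1 ∧ Valued.v w.imI ≤ 1 ∧ Valued.v w.imJ ≤ 1 ∧ Valued.v w.imK ≤ 1 := by
    simp only [hw, hm1, _root_.QuaternionAlgebra.re_smul, _root_.QuaternionAlgebra.imI_smul,
      _root_.QuaternionAlgebra.imJ_smul, _root_.QuaternionAlgebra.imK_smul,
      _root_.QuaternionAlgebra.re_star, _root_.QuaternionAlgebra.imI_star,
      _root_.QuaternionAlgebra.imJ_star, _root_.QuaternionAlgebra.imK_star,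
      _root_.QuaternionAlgebra.re_add, _root_.QuaternionAlgebra.imI_add,
      _root_.QuaternionAlgebra.imJ_add, _root_.QuaternionAlgebra.imK_add,
      _root_.QuaternionAlgebra.re_one, _root_.QuaternionAlgebra.imI_one,
      _root_.QuaternionAlgebra.imJ_one, _root_.QuaternionAlgebra.imK_one, smul_eq_mul, map_mul,
      hvNinv, one_mul, Valuation.map_neg, zero_mul, add_zero, zero_add]
    refine ⟨?_, hεE.2.1.trans hE1.le, hεE.2.2.1.trans hE1.le, hεE.2.2.2.trans hE1.le⟩
    have h1 : Valued.v ε.re ≤ Valued.v (1 : Kᵥ) := by rw [map_one]; exact hεE.1.trans hE1.le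
    simpa only [map_one] using Valuation.map_add_le _ (le_refl (Valued.v (1 : Kᵥ))) h1
  have hfin := valued_mul_le (ε * g - g * ε) w hdiff hw1
  have hfinal : C * (C * E * M) * 1 ≤ r := by
    calc C * (C * E * M) * 1 = (C * C * M) * E := by rw [mul_one]; ac_rfl
      _ ≤ (C * C * M) * (r * (C * C * M)⁻¹) := mul_le_mul' le_rfl hEr
      _ = r := by
          rw [mul_comm r, ← mul_assoc, mul_inv_cancel₀ (mul_ne_zero (mul_ne_zero hC0 hC0) hM0),
            one_mul]
  exact ⟨hfin.1.trans hfinal, hfin.2.1.trans hfinal, hfin.2.2.1.trans hfinal, hfin.2.2.2.trans hfinal⟩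

end Local

/-! ### Global preliminaries: boxes, conjugation invariance of `𝓐`, tuples, density -/

section Global

/-- `ℍ⟮K; R; a, b⟯ := ℍ[K, algebraMap R K a, algebraMap R K b]` (file-local notation, as in
`QuaternionCoordOrder`). -/
local notation "ℍ⟮" K "; " R "; " a ", " b "⟯" =>
  QuaternionAlgebra K (algebraMap R K a) (0 : K) (algebraMap R K b)

variable {K : Type} [Field K] [NumberField K] (a b : 𝓞 K)

/-- `𝔸_K^∞`. -/
local notation "𝔸ᶠ" => FiniteAdeleRing (𝓞 K) K

/-- `K_w`. -/
local notation "K_" w => HeightOneSpectrum.adicCompletion K w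

/-- `𝒪_w`. -/
local notation "𝒪_" w => HeightOneSpectrum.adicCompletionIntegers K w

/-- Coordinate boxes are monotone. [folklore] -/
theorem coordBox_mono {V W : Set 𝔸ᶠ} (h : V ⊆ W) : coordBox a b V ⊆ coordBox a b W :=
  fun _ ⟨h₀, h₁, h₂, h₃⟩ => ⟨h h₀, h h₁, h h₂, h h₃⟩

/-- `0` lies in the box of a set containing `0`. [folklore] -/
theorem zero_mem_coordBox {V : Set 𝔸ᶠ} (h0 : (0 : 𝔸ᶠ) ∈ V) : (0 : ℍ⟮𝔸ᶠ; 𝓞 K; a, b⟯) ∈ coordBox a b V :=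
  ⟨h0, h0, h0, h0⟩

/-- **Left and right multiplication are continuous at `0` in coordinates**: for `y` and an open
`W ∋ 0` there is an open `W' ∋ 0` with `y d, d y ∈ box(W)` for all `d ∈ box(W')`
(`exists_open_mul_sub_mul_mem_coordBox`). [folklore] -/
theorem exists_open_forall_mul_mem_coordBox (y : ℍ⟮𝔸ᶠ; 𝓞 K; a, b⟯) {W : Set 𝔸ᶠ} (hW : IsOpen W)
    (h0 : (0 : 𝔸ᶠ) ∈ W) :
    ∃ W' : Set 𝔸ᶠ, IsOpen W' ∧ (0 : 𝔸ᶠ) ∈ W' ∧ ∀ d : ℍ⟮𝔸ᶠ; 𝓞 K; a, b⟯, d ∈ coordBox a b W' →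
      y * d ∈ coordBox a b W ∧ d * y ∈ coordBox a b W := by
  obtain ⟨W₁, hW₁, h0₁, h₁⟩ := exists_open_mul_sub_mul_mem_coordBox a b y 0 hW h0
  obtain ⟨W₂, hW₂, h0₂, h₂⟩ := exists_open_mul_sub_mul_mem_coordBox a b 0 y hW h0
  refine ⟨W₁ ∩ W₂, hW₁.inter hW₂, ⟨h0₁, h0₂⟩, fun d hd => ⟨?_, ?_⟩⟩
  · have h := h₁ 0 d (zero_mem_coordBox a b h0₁) (coordBox_mono a b Set.inter_subset_left hd)
    simpa only [add_zero, zero_add, mul_zero, sub_zero] using h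
  · have h := h₂ d 0 (coordBox_mono a b Set.inter_subset_right hd) (zero_mem_coordBox a b h0₂)
    simpa only [add_zero, zero_add, zero_mul, sub_zero] using h

/-- The units map `ι : ℍ^× → ℍ[𝔸_K^∞,a,b]^×`, on values. [folklore] -/
theorem val_unitsMap_toFiniteAdele (k : (ℍ⟮K; 𝓞 K; a, b⟯)ˣ) :
    ((Units.map (toFiniteAdele a b).toMonoidHom k : (ℍ⟮𝔸ᶠ; 𝓞 K; a, b⟯)ˣ) : ℍ⟮𝔸ᶠ; 𝓞 K; a, b⟯) = toFiniteAdele a b k := rfl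

/-- The units map `ι : ℍ^× → ℍ[𝔸_K^∞,a,b]^×`, on inverses. [folklore] -/
theorem val_inv_unitsMap_toFiniteAdele (k : (ℍ⟮K; 𝓞 K; a, b⟯)ˣ) :
    (((Units.map (toFiniteAdele a b).toMonoidHom k)⁻¹ : (ℍ⟮𝔸ᶠ; 𝓞 K; a, b⟯)ˣ) : ℍ⟮𝔸ᶠ; 𝓞 K; a, b⟯) =
      toFiniteAdele a b ((k⁻¹ : (ℍ⟮K; 𝓞 K; a, b⟯)ˣ) : ℍ⟮K; 𝓞 K; a, b⟯) := rfl

/-- **`𝓐` is stable under conjugation by `ι(ℍ^×)`** (`ℍ¹` is normalised by `ℍ^×`, and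
conjugation by a fixed element is continuous in coordinates; Vignéras III §4, proof of Thm. 4.3:
"`adh(H_K^1 H_S^1)` est stable par `H_K^×`"). [cite: VignerasLNM800, Ch. III §4 (proof of Thm. 4.3)] -/
theorem conj_mem_approximable (k : (ℍ⟮K; 𝓞 K; a, b⟯)ˣ) {z : ℍ⟮𝔸ᶠ; 𝓞 K; a, b⟯} (hz : z ∈ approximable a b) :
    ((Units.map (toFiniteAdele a b).toMonoidHom k : (ℍ⟮𝔸ᶠ; 𝓞 K; a, b⟯)ˣ) : ℍ⟮𝔸ᶠ; 𝓞 K; a, b⟯) * z *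
      (((Units.map (toFiniteAdele a b).toMonoidHom k)⁻¹ : (ℍ⟮𝔸ᶠ; 𝓞 K; a, b⟯)ˣ) : ℍ⟮𝔸ᶠ; 𝓞 K; a, b⟯) ∈ approximable a b := by
  intro W hW h0
  obtain ⟨W₁, hW₁, h0₁, h₁⟩ :=
    exists_open_forall_mul_mem_coordBox a b (toFiniteAdele a b (k : ℍ⟮K; 𝓞 K; a, b⟯)) hW h0
  obtain ⟨W₂, hW₂, h0₂, h₂⟩ := exists_open_forall_mul_mem_coordBox a b
    (toFiniteAdele a b ((k⁻¹ : (ℍ⟮K; 𝓞 K; a, b⟯)ˣ) : ℍ⟮K; 𝓞 K; a, b⟯)) hW₁ h0₁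
  obtain ⟨x, hx1, hx⟩ := hz W₂ hW₂ h0₂
  refine ⟨(k : ℍ⟮K; 𝓞 K; a, b⟯) * x * ((k⁻¹ : (ℍ⟮K; 𝓞 K; a, b⟯)ˣ) : ℍ⟮K; 𝓞 K; a, b⟯),
    conj_mul_star_eq_one k hx1, ?_⟩
  rw [val_unitsMap_toFiniteAdele, val_inv_unitsMap_toFiniteAdele]
  have e : toFiniteAdele a b ((k : ℍ⟮K; 𝓞 K; a, b⟯) * x * ((k⁻¹ : (ℍ⟮K; 𝓞 K; a, b⟯)ˣ) :
      ℍ⟮K; 𝓞 K; a, b⟯)) - toFiniteAdele a b (k : ℍ⟮K; 𝓞 K; a, b⟯) * z *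
        toFiniteAdele a b ((k⁻¹ : (ℍ⟮K; 𝓞 K; a, b⟯)ˣ) : ℍ⟮K; 𝓞 K; a, b⟯) =
      toFiniteAdele a b (k : ℍ⟮K; 𝓞 K; a, b⟯) * ((toFiniteAdele a b x - z) *
        toFiniteAdele a b ((k⁻¹ : (ℍ⟮K; 𝓞 K; a, b⟯)ˣ) : ℍ⟮K; 𝓞 K; a, b⟯)) := by
    rw [map_mul, map_mul]
    noncomm_ring
  rw [e]
  exact (h₁ _ (h₂ _ hx).2).1

/-- The coordinate tuple of `q`. [folklore] -/
theorem linearEquivTuple_apply' (q : ℍ⟮𝔸ᶠ; 𝓞 K; a, b⟯) :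
    _root_.QuaternionAlgebra.linearEquivTuple (algebraMap (𝓞 K) 𝔸ᶠ a) (0 : 𝔸ᶠ)
      (algebraMap (𝓞 K) 𝔸ᶠ b) q = ![q.re, q.imI, q.imJ, q.imK] := by
  rw [_root_.QuaternionAlgebra.coe_linearEquivTuple, _root_.QuaternionAlgebra.equivTuple_apply]

/-- The inverse of the coordinate tuple map. [folklore] -/
theorem linearEquivTuple_symm_apply' (p : Fin 4 → 𝔸ᶠ) :
    (_root_.QuaternionAlgebra.linearEquivTuple (algebraMap (𝓞 K) 𝔸ᶠ a) (0 : 𝔸ᶠ)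
      (algebraMap (𝓞 K) 𝔸ᶠ b)).symm p = ⟨p 0, p 1, p 2, p 3⟩ := by
  rw [_root_.QuaternionAlgebra.coe_linearEquivTuple_symm, _root_.QuaternionAlgebra.equivTuple_symm_apply]

/-- A tuple lies in the box `S⁴` iff the four coordinates lie in `S`. [folklore] -/
theorem linearEquivTuple_mem_pi_iff {S : Set 𝔸ᶠ} (q : ℍ⟮𝔸ᶠ; 𝓞 K; a, b⟯) :
    _root_.QuaternionAlgebra.linearEquivTuple (algebraMap (𝓞 K) 𝔸ᶠ a) (0 : 𝔸ᶠ)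
      (algebraMap (𝓞 K) 𝔸ᶠ b) q ∈ Set.pi Set.univ (fun _ => S) ↔
      q.re ∈ S ∧ q.imI ∈ S ∧ q.imJ ∈ S ∧ q.imK ∈ S := by
  rw [linearEquivTuple_apply']
  simp only [Set.mem_pi, Set.mem_univ, true_implies, Fin.forall_fin_succ, IsEmpty.forall_iff,
    Matrix.cons_val_zero, Matrix.cons_val_succ, and_true]

/-- **Neighbourhoods of `0` in `(𝔸_K^∞)⁴` contain coordinate boxes**: if `M ∈ 𝓝 0` there is an
open `W ∋ 0` of `𝔸_K^∞` such that the tuple of every `d ∈ box(W)` lies in `M`. [folklore] -/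
theorem exists_open_forall_tuple_mem {M : Set (Fin 4 → 𝔸ᶠ)} (hM : M ∈ 𝓝 (0 : Fin 4 → 𝔸ᶠ)) :
    ∃ W : Set 𝔸ᶠ, IsOpen W ∧ (0 : 𝔸ᶠ) ∈ W ∧ ∀ d : ℍ⟮𝔸ᶠ; 𝓞 K; a, b⟯, d ∈ coordBox a b W →
      _root_.QuaternionAlgebra.linearEquivTuple (algebraMap (𝓞 K) 𝔸ᶠ a) (0 : 𝔸ᶠ)
        (algebraMap (𝓞 K) 𝔸ᶠ b) d ∈ M := by
  rw [nhds_pi, Filter.mem_pi] at hM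
  obtain ⟨I, -, t, ht, hI⟩ := hM
  have hW : (⋂ i, t i) ∈ 𝓝 (0 : 𝔸ᶠ) := Filter.iInter_mem.2 fun i => ht i
  obtain ⟨W, hWsub, hWopen, h0⟩ := mem_nhds_iff.mp hW
  refine ⟨W, hWopen, h0, fun d hd => hI fun i _ => ?_⟩
  have hsub : W ⊆ t i := hWsub.trans (Set.iInter_subset _ i)
  obtain ⟨h₀, h₁, h₂, h₃⟩ := hd
  rw [linearEquivTuple_apply']
  fin_cases i
  · exact hsub h₀
  · exact hsub h₁
  · exact hsub h₂
  · exact hsub h₃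

/-- The norm form commutes with `ι_w`: `n(ι_w(y)) = n(y) ∈ K ⊆ K_w`. [folklore] -/
theorem normForm_toAdicCompletion (w : HeightOneSpectrum (𝓞 K)) (y : ℍ⟮K; 𝓞 K; a, b⟯) :
    (toAdicCompletion a b w y).re ^ 2 -
        algebraMap (𝒪_ w) (K_ w) (algebraMap (𝓞 K) (𝒪_ w) a) * (toAdicCompletion a b w y).imI ^ 2 -
        algebraMap (𝒪_ w) (K_ w) (algebraMap (𝓞 K) (𝒪_ w) b) * (toAdicCompletion a b w y).imJ ^ 2 +
        algebraMap (𝒪_ w) (K_ w) (algebraMap (𝓞 K) (𝒪_ w) a) *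
          algebraMap (𝒪_ w) (K_ w) (algebraMap (𝓞 K) (𝒪_ w) b) * (toAdicCompletion a b w y).imK ^ 2 =
      algebraMap K (K_ w) (y.re ^ 2 - algebraMap (𝓞 K) K a * y.imI ^ 2 -
        algebraMap (𝓞 K) K b * y.imJ ^ 2 + algebraMap (𝓞 K) K a * algebraMap (𝓞 K) K b * y.imK ^ 2) := by
  rw [toAdicCompletion_apply]
  simp only [map_add, map_sub, map_mul, map_pow]
  rfl

/-- **Density of `K` in `K_w` to any precision**: every `x ∈ K_w` is within `ρ` (`ρ ≠ 0`) of an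
element of `K` (Mathlib `HeightOneSpectrum.denseRange_algebraMap`). [folklore] -/
theorem exists_valued_algebraMap_sub_le (w : HeightOneSpectrum (𝓞 K)) (x : K_ w) {ρ : ℤᵐ⁰}
    (hρ : ρ ≠ 0) : ∃ k : K, Valued.v (algebraMap K (K_ w) k - x) ≤ ρ := by
  obtain ⟨z, hz⟩ := HeightOneSpectrum.valuedAdicCompletion_surjective K w ρ
  have hz0 : z ≠ 0 := fun h => hρ (by rw [← hz, h, map_zero])
  have hopen : IsOpen {y : K_ w | Valued.v (y - x) < Valued.v z} := by
    have h1 : IsOpen {y : K_ w | Valued.v y < Valued.v z} := by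
      simpa only [Valuation.restrict_lt_iff] using Valued.isOpen_ball (K_ w) (Valued.v.restrict z)
    exact h1.preimage (continuous_id.sub continuous_const)
  obtain ⟨k, hk⟩ := (HeightOneSpectrum.denseRange_algebraMap K w).exists_mem_open hopen
    ⟨x, by simp [pos_iff_ne_zero, (Valuation.ne_zero_iff _).mpr hz0]⟩
  rw [Set.mem_setOf_eq, hz] at hk
  exact ⟨k, hk.le⟩

/-! ### Continuity of coordinates of polynomial expressions -/

/-- Continuity of the tuple of an `ℍ[𝔸_K^∞,a,b]`-valued map with continuous coordinates. [folklore] -/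
theorem continuous_linearEquivTuple_comp {X : Type*} [TopologicalSpace X] {f : X → ℍ⟮𝔸ᶠ; 𝓞 K; a, b⟯}
    (h : (Continuous fun x => (f x).re) ∧ (Continuous fun x => (f x).imI) ∧
      (Continuous fun x => (f x).imJ) ∧ (Continuous fun x => (f x).imK)) :
    Continuous fun x => _root_.QuaternionAlgebra.linearEquivTuple (algebraMap (𝓞 K) 𝔸ᶠ a) (0 : 𝔸ᶠ) (algebraMap (𝓞 K) 𝔸ᶠ b) (f x) := by
  obtain ⟨h₀, h₁, h₂, h₃⟩ := h
  refine continuous_pi fun i => ?_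
  simp only [linearEquivTuple_apply']
  fin_cases i
  · simpa using h₀
  · simpa using h₁
  · simpa using h₂
  · simpa using h₃

/-- Constant maps have continuous coordinates. [folklore] -/
theorem contCoords_const {X : Type*} [TopologicalSpace X] (q : ℍ⟮𝔸ᶠ; 𝓞 K; a, b⟯) :
    (Continuous fun _ : X => q.re) ∧ (Continuous fun _ : X => q.imI) ∧
      (Continuous fun _ : X => q.imJ) ∧ (Continuous fun _ : X => q.imK) :=
  ⟨continuous_const, continuous_const, continuous_const, continuous_const⟩

/-- The inverse tuple map composed with a continuous map has continuous coordinates. [folklore] -/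
theorem contCoords_symm {X : Type*} [TopologicalSpace X] {p : X → Fin 4 → 𝔸ᶠ} (hp : Continuous p) :
    (Continuous fun x => ((_root_.QuaternionAlgebra.linearEquivTuple (algebraMap (𝓞 K) 𝔸ᶠ a) (0 : 𝔸ᶠ) (algebraMap (𝓞 K) 𝔸ᶠ b)).symm (p x)).re) ∧ (Continuous fun x => ((_root_.QuaternionAlgebra.linearEquivTuple (algebraMap (𝓞 K) 𝔸ᶠ a) (0 : 𝔸ᶠ) (algebraMap (𝓞 K) 𝔸ᶠ b)).symm (p x)).imI) ∧
      (Continuous fun x => ((_root_.QuaternionAlgebra.linearEquivTuple (algebraMap (𝓞 K) 𝔸ᶠ a) (0 : 𝔸ᶠ) (algebraMap (𝓞 K) 𝔸ᶠ b)).symm (p x)).imJ) ∧ (Continuous fun x => ((_root_.QuaternionAlgebra.linearEquivTuple (algebraMap (𝓞 K) 𝔸ᶠ a) (0 : 𝔸ᶠ) (algebraMap (𝓞 K) 𝔸ᶠ b)).symm (p x)).imK) := by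
  simp only [linearEquivTuple_symm_apply']
  exact ⟨(continuous_apply 0).comp hp, (continuous_apply 1).comp hp, (continuous_apply 2).comp hp,
    (continuous_apply 3).comp hp⟩

/-- Products of maps with continuous coordinates have continuous coordinates (the coordinates of
a product are polynomials). [folklore] -/
theorem contCoords_mul {X : Type*} [TopologicalSpace X] {f g : X → ℍ⟮𝔸ᶠ; 𝓞 K; a, b⟯}
    (hf : (Continuous fun x => (f x).re) ∧ (Continuous fun x => (f x).imI) ∧
      (Continuous fun x => (f x).imJ) ∧ (Continuous fun x => (f x).imK))
    (hg : (Continuous fun x => (g x).re) ∧ (Continuous fun x => (g x).imI) ∧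
      (Continuous fun x => (g x).imJ) ∧ (Continuous fun x => (g x).imK)) :
    (Continuous fun x => (f x * g x).re) ∧ (Continuous fun x => (f x * g x).imI) ∧
      (Continuous fun x => (f x * g x).imJ) ∧ (Continuous fun x => (f x * g x).imK) := by
  obtain ⟨f₀, f₁, f₂, f₃⟩ := hf
  obtain ⟨g₀, g₁, g₂, g₃⟩ := hg
  simp only [_root_.QuaternionAlgebra.re_mul, _root_.QuaternionAlgebra.imI_mul,
    _root_.QuaternionAlgebra.imJ_mul, _root_.QuaternionAlgebra.imK_mul, zero_mul, add_zero]
  exact ⟨by fun_prop, by fun_prop, by fun_prop, by fun_prop⟩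

/-- Sums of maps with continuous coordinates have continuous coordinates. [folklore] -/
theorem contCoords_add {X : Type*} [TopologicalSpace X] {f g : X → ℍ⟮𝔸ᶠ; 𝓞 K; a, b⟯}
    (hf : (Continuous fun x => (f x).re) ∧ (Continuous fun x => (f x).imI) ∧
      (Continuous fun x => (f x).imJ) ∧ (Continuous fun x => (f x).imK))
    (hg : (Continuous fun x => (g x).re) ∧ (Continuous fun x => (g x).imI) ∧
      (Continuous fun x => (g x).imJ) ∧ (Continuous fun x => (g x).imK)) :
    (Continuous fun x => (f x + g x).re) ∧ (Continuous fun x => (f x + g x).imI) ∧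
      (Continuous fun x => (f x + g x).imJ) ∧ (Continuous fun x => (f x + g x).imK) := by
  obtain ⟨f₀, f₁, f₂, f₃⟩ := hf
  obtain ⟨g₀, g₁, g₂, g₃⟩ := hg
  simp only [_root_.QuaternionAlgebra.re_add, _root_.QuaternionAlgebra.imI_add,
    _root_.QuaternionAlgebra.imJ_add, _root_.QuaternionAlgebra.imK_add]
  exact ⟨f₀.add g₀, f₁.add g₁, f₂.add g₂, f₃.add g₃⟩

/-- Differences of maps with continuous coordinates have continuous coordinates. [folklore] -/
theorem contCoords_sub {X : Type*} [TopologicalSpace X] {f g : X → ℍ⟮𝔸ᶠ; 𝓞 K; a, b⟯}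
    (hf : (Continuous fun x => (f x).re) ∧ (Continuous fun x => (f x).imI) ∧
      (Continuous fun x => (f x).imJ) ∧ (Continuous fun x => (f x).imK))
    (hg : (Continuous fun x => (g x).re) ∧ (Continuous fun x => (g x).imI) ∧
      (Continuous fun x => (g x).imJ) ∧ (Continuous fun x => (g x).imK)) :
    (Continuous fun x => (f x - g x).re) ∧ (Continuous fun x => (f x - g x).imI) ∧
      (Continuous fun x => (f x - g x).imJ) ∧ (Continuous fun x => (f x - g x).imK) := by
  obtain ⟨f₀, f₁, f₂, f₃⟩ := hf
  obtain ⟨g₀, g₁, g₂, g₃⟩ := hg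
  simp only [_root_.QuaternionAlgebra.re_sub, _root_.QuaternionAlgebra.imI_sub,
    _root_.QuaternionAlgebra.imJ_sub, _root_.QuaternionAlgebra.imK_sub]
  exact ⟨f₀.sub g₀, f₁.sub g₁, f₂.sub g₂, f₃.sub g₃⟩

/-- The set where an `ℍ[𝔸_K^∞,a,b]`-valued map with continuous coordinates takes values in the
box of an open set is open. [folklore] -/
theorem isOpen_setOf_mem_coordBox {X : Type*} [TopologicalSpace X] {f : X → ℍ⟮𝔸ᶠ; 𝓞 K; a, b⟯}
    (hf : (Continuous fun x => (f x).re) ∧ (Continuous fun x => (f x).imI) ∧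
      (Continuous fun x => (f x).imJ) ∧ (Continuous fun x => (f x).imK))
    {W : Set 𝔸ᶠ} (hW : IsOpen W) : IsOpen {x | f x ∈ coordBox a b W} := by
  obtain ⟨f₀, f₁, f₂, f₃⟩ := hf
  have h := (((hW.preimage f₀).inter (hW.preimage f₁)).inter (hW.preimage f₂)).inter (hW.preimage f₃)
  convert h using 1
  ext x
  simp only [Set.mem_setOf_eq, Set.mem_inter_iff, Set.mem_preimage, mem_coordBox_iff, and_assoc]

/-! ### The closure argument (Vignéras III §4, proof of Thm. 4.3, last two steps) -/

set_option maxHeartbeats 800000 in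
/-- **From conjugates approaching `a` to `a ∈ 𝓐`.** Let `a, b ≠ 0`, `w₀` a finite place,
`g ∈ ℍ[K_{w₀},a,b]¹`, `A = (g at w₀, 1 elsewhere)`, and suppose that for every open `V ∋ 0` of
`𝔸_K^∞` some `y ∈ ℍ¹` and some unit `h` of `ℍ[𝔸_K^∞,a,b]` have `h ι(y) h⁻¹ - A ∈ box(V)`. Then
`A ∈ 𝓐 = adh ι(ℍ¹)`. Proof (Vignéras, LNM 800 p. 81): write `h⁻¹ = ι(γ) t u` with `t` in the
finite set of `exists_finset_units_eq` and `u ∈ Ô^×`, so that `ι(γ⁻¹ y γ) = c z c⁻¹`, `c = tu`,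
`z → A`; along the filter of shrinking boxes `t` is frequently a fixed `t₀` and `(u, u⁻¹)` clusters
at some `(û, û')` of the compact `Ô × Ô` (`𝒪̂_K` compact), `û û' = û' û = 1`; continuity of the
product in coordinates gives `t₀ û A û' t₀⁻¹ ∈ 𝓐`; finally conjugate by `ι(β)`, `β ∈ ℍ^×` close
at `w₀` to `(t₀ û)⁻¹` (density of `K` in `K_{w₀}`, `exists_forall_conj_near_of_near_inv`,
`conj_mem_approximable`): the conjugates are in `𝓐`, equal to `1 = A_w` away from `w₀` and close to
`g` at `w₀`, and `𝓐` is closed. [cite: VignerasLNM800, Ch. III §4 Thm. 4.3 (proof)] -/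
theorem extendOne_mem_approximable_of_forall_conj (ha : a ≠ 0) (hb : b ≠ 0)
    (w₀ : HeightOneSpectrum (𝓞 K)) (g : ℍ⟮K_ w₀; 𝒪_ w₀; algebraMap (𝓞 K) (𝒪_ w₀) a, algebraMap (𝓞 K) (𝒪_ w₀) b⟯) (hA : ∀ V : Set 𝔸ᶠ, IsOpen V → (0 : 𝔸ᶠ) ∈ V →
      ∃ y : ℍ⟮K; 𝓞 K; a, b⟯, y * star y = 1 ∧ ∃ h : (ℍ⟮𝔸ᶠ; 𝓞 K; a, b⟯)ˣ,
        (h : ℍ⟮𝔸ᶠ; 𝓞 K; a, b⟯) * toFiniteAdele a b y * ((h⁻¹ : (ℍ⟮𝔸ᶠ; 𝓞 K; a, b⟯)ˣ) : ℍ⟮𝔸ᶠ; 𝓞 K; a, b⟯) - extendOne a b w₀ g ∈ coordBox a b V) :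
    extendOne a b w₀ g ∈ approximable a b := by
  classical
  haveI : T2Space 𝔸ᶠ := t2Space_finiteAdeleRing K
  obtain ⟨A, hAdef⟩ : ∃ A : ℍ⟮𝔸ᶠ; 𝓞 K; a, b⟯, A = extendOne a b w₀ g := ⟨_, rfl⟩
  rw [← hAdef] at hA ⊢
  have hAw : ∀ w : HeightOneSpectrum (𝓞 K), w ≠ w₀ → localComp a b w A = 1 := fun w hw => by
    rw [hAdef]; exact localComp_extendOne_of_ne a b w₀ g hw
  have hAw₀ : localComp a b w₀ A = g := by rw [hAdef]; exact localComp_extendOne_self a b w₀ g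
  obtain ⟨e, he⟩ : ∃ e : ℍ⟮𝔸ᶠ; 𝓞 K; a, b⟯ ≃ₗ[𝔸ᶠ] (Fin 4 → 𝔸ᶠ), e = _root_.QuaternionAlgebra.linearEquivTuple (algebraMap (𝓞 K) 𝔸ᶠ a) (0 : 𝔸ᶠ) (algebraMap (𝓞 K) 𝔸ᶠ b) := ⟨_, rfl⟩
  -- (1) the finite set `T` and the choices attached to every open neighbourhood of `0`
  obtain ⟨T, hT⟩ := exists_finset_units_eq a b ha hb
  have hch : ∀ V : OpenNhdsOf (0 : 𝔸ᶠ), ∃ (y' : ℍ⟮K; 𝓞 K; a, b⟯) (t u : (ℍ⟮𝔸ᶠ; 𝓞 K; a, b⟯)ˣ) (z : ℍ⟮𝔸ᶠ; 𝓞 K; a, b⟯),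
      y' * star y' = 1 ∧ t ∈ T ∧ (u : ℍ⟮𝔸ᶠ; 𝓞 K; a, b⟯) ∈ adelicOrder a b ∧
      ((u⁻¹ : (ℍ⟮𝔸ᶠ; 𝓞 K; a, b⟯)ˣ) : ℍ⟮𝔸ᶠ; 𝓞 K; a, b⟯) ∈ adelicOrder a b ∧ z - A ∈ coordBox a b (V : Set 𝔸ᶠ) ∧
      toFiniteAdele a b y' = (t : ℍ⟮𝔸ᶠ; 𝓞 K; a, b⟯) * (u : ℍ⟮𝔸ᶠ; 𝓞 K; a, b⟯) * z * (((u⁻¹ : (ℍ⟮𝔸ᶠ; 𝓞 K; a, b⟯)ˣ) : ℍ⟮𝔸ᶠ; 𝓞 K; a, b⟯) * ((t⁻¹ : (ℍ⟮𝔸ᶠ; 𝓞 K; a, b⟯)ˣ) : ℍ⟮𝔸ᶠ; 𝓞 K; a, b⟯)) := by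
    intro V
    obtain ⟨y, hy1, h, hh⟩ := hA (V : Set 𝔸ᶠ) V.isOpen V.mem
    obtain ⟨γ, t, ht, u, hu, hu', hdec⟩ := hT h⁻¹
    refine ⟨((γ⁻¹ : (ℍ⟮K; 𝓞 K; a, b⟯)ˣ) : ℍ⟮K; 𝓞 K; a, b⟯) * y * ((γ⁻¹⁻¹ : (ℍ⟮K; 𝓞 K; a, b⟯)ˣ) : ℍ⟮K; 𝓞 K; a, b⟯), t, u,
      (h : ℍ⟮𝔸ᶠ; 𝓞 K; a, b⟯) * toFiniteAdele a b y * ((h⁻¹ : (ℍ⟮𝔸ᶠ; 𝓞 K; a, b⟯)ˣ) : ℍ⟮𝔸ᶠ; 𝓞 K; a, b⟯), conj_mul_star_eq_one γ⁻¹ hy1, ht, hu,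
      hu', hh, ?_⟩
    have hh' : (h : ℍ⟮𝔸ᶠ; 𝓞 K; a, b⟯) = ((u⁻¹ : (ℍ⟮𝔸ᶠ; 𝓞 K; a, b⟯)ˣ) : ℍ⟮𝔸ᶠ; 𝓞 K; a, b⟯) * ((t⁻¹ : (ℍ⟮𝔸ᶠ; 𝓞 K; a, b⟯)ˣ) : ℍ⟮𝔸ᶠ; 𝓞 K; a, b⟯) *
        toFiniteAdele a b ((γ⁻¹ : (ℍ⟮K; 𝓞 K; a, b⟯)ˣ) : ℍ⟮K; 𝓞 K; a, b⟯) := by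
      have h1 := congrArg (fun x : (ℍ⟮𝔸ᶠ; 𝓞 K; a, b⟯)ˣ => ((x⁻¹ : (ℍ⟮𝔸ᶠ; 𝓞 K; a, b⟯)ˣ) : ℍ⟮𝔸ᶠ; 𝓞 K; a, b⟯)) hdec
      simpa only [inv_inv, mul_inv_rev, Units.val_mul, val_inv_unitsMap_toFiniteAdele,
        mul_assoc] using h1
    have hh'' : ((h⁻¹ : (ℍ⟮𝔸ᶠ; 𝓞 K; a, b⟯)ˣ) : ℍ⟮𝔸ᶠ; 𝓞 K; a, b⟯) = toFiniteAdele a b (γ : ℍ⟮K; 𝓞 K; a, b⟯) * (t : ℍ⟮𝔸ᶠ; 𝓞 K; a, b⟯) * (u : ℍ⟮𝔸ᶠ; 𝓞 K; a, b⟯) := by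
      have h1 := congrArg (fun x : (ℍ⟮𝔸ᶠ; 𝓞 K; a, b⟯)ˣ => (x : ℍ⟮𝔸ᶠ; 𝓞 K; a, b⟯)) hdec
      simpa only [Units.val_mul, val_unitsMap_toFiniteAdele] using h1
    rw [inv_inv, map_mul, map_mul, hh', hh'']
    have e1 : (t : ℍ⟮𝔸ᶠ; 𝓞 K; a, b⟯) * (u : ℍ⟮𝔸ᶠ; 𝓞 K; a, b⟯) * (((u⁻¹ : (ℍ⟮𝔸ᶠ; 𝓞 K; a, b⟯)ˣ) : ℍ⟮𝔸ᶠ; 𝓞 K; a, b⟯) * ((t⁻¹ : (ℍ⟮𝔸ᶠ; 𝓞 K; a, b⟯)ˣ) : ℍ⟮𝔸ᶠ; 𝓞 K; a, b⟯) *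
        toFiniteAdele a b ((γ⁻¹ : (ℍ⟮K; 𝓞 K; a, b⟯)ˣ) : ℍ⟮K; 𝓞 K; a, b⟯) * toFiniteAdele a b y *
        (toFiniteAdele a b (γ : ℍ⟮K; 𝓞 K; a, b⟯) * (t : ℍ⟮𝔸ᶠ; 𝓞 K; a, b⟯) * (u : ℍ⟮𝔸ᶠ; 𝓞 K; a, b⟯))) * (((u⁻¹ : (ℍ⟮𝔸ᶠ; 𝓞 K; a, b⟯)ˣ) : ℍ⟮𝔸ᶠ; 𝓞 K; a, b⟯) * ((t⁻¹ : (ℍ⟮𝔸ᶠ; 𝓞 K; a, b⟯)ˣ) : ℍ⟮𝔸ᶠ; 𝓞 K; a, b⟯)) =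
        ((t : ℍ⟮𝔸ᶠ; 𝓞 K; a, b⟯) * ((u : ℍ⟮𝔸ᶠ; 𝓞 K; a, b⟯) * ((u⁻¹ : (ℍ⟮𝔸ᶠ; 𝓞 K; a, b⟯)ˣ) : ℍ⟮𝔸ᶠ; 𝓞 K; a, b⟯)) * ((t⁻¹ : (ℍ⟮𝔸ᶠ; 𝓞 K; a, b⟯)ˣ) : ℍ⟮𝔸ᶠ; 𝓞 K; a, b⟯)) *
          toFiniteAdele a b ((γ⁻¹ : (ℍ⟮K; 𝓞 K; a, b⟯)ˣ) : ℍ⟮K; 𝓞 K; a, b⟯) * toFiniteAdele a b y * toFiniteAdele a b (γ : ℍ⟮K; 𝓞 K; a, b⟯) *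
          ((t : ℍ⟮𝔸ᶠ; 𝓞 K; a, b⟯) * ((u : ℍ⟮𝔸ᶠ; 𝓞 K; a, b⟯) * ((u⁻¹ : (ℍ⟮𝔸ᶠ; 𝓞 K; a, b⟯)ˣ) : ℍ⟮𝔸ᶠ; 𝓞 K; a, b⟯)) * ((t⁻¹ : (ℍ⟮𝔸ᶠ; 𝓞 K; a, b⟯)ˣ) : ℍ⟮𝔸ᶠ; 𝓞 K; a, b⟯)) := by
      simp only [mul_assoc]
    rw [e1, Units.mul_inv, mul_one, Units.mul_inv, one_mul, mul_one]
  choose y' t u z hy' ht hu hu' hz hι using hch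
  -- (2) `t` is frequently some `t₀ ∈ T` along the shrinking neighbourhoods
  obtain ⟨t₀, -, hfreq⟩ : ∃ t₀ ∈ T, ∃ᶠ V in (atBot : Filter (OpenNhdsOf (0 : 𝔸ᶠ))), t V = t₀ := by
    by_contra hcon
    push Not at hcon
    have hev : ∀ᶠ V in (atBot : Filter (OpenNhdsOf (0 : 𝔸ᶠ))), ∀ t₀ ∈ T, t V ≠ t₀ :=
      (Filter.eventually_all_finset T).mpr fun t₀ ht₀ => hcon t₀ ht₀
    obtain ⟨V, hV⟩ := hev.exists
    exact hV (t V) (ht V) rfl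
  obtain ⟨𝓕, h𝓕⟩ : ∃ 𝓕 : Filter (OpenNhdsOf (0 : 𝔸ᶠ)), 𝓕 = atBot ⊓ 𝓟 {V | t V = t₀} := ⟨_, rfl⟩
  haveI h𝓕ne : 𝓕.NeBot := by rw [h𝓕]; exact Filter.frequently_iff_neBot.mp hfreq
  -- (3) a cluster point of `(u, u⁻¹)` in the compact `Ô × Ô`
  obtain ⟨G, hG⟩ : ∃ G : OpenNhdsOf (0 : 𝔸ᶠ) → (Fin 4 → 𝔸ᶠ) × (Fin 4 → 𝔸ᶠ),
      G = fun V => (e (u V : ℍ⟮𝔸ᶠ; 𝓞 K; a, b⟯), e ((u V)⁻¹ : (ℍ⟮𝔸ᶠ; 𝓞 K; a, b⟯)ˣ)) := ⟨_, rfl⟩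
  obtain ⟨C, hC⟩ : ∃ C : Set ((Fin 4 → 𝔸ᶠ) × (Fin 4 → 𝔸ᶠ)),
      C = (Set.pi Set.univ fun _ => (integralFiniteAdeles K : Set 𝔸ᶠ)) ×ˢ
        (Set.pi Set.univ fun _ => (integralFiniteAdeles K : Set 𝔸ᶠ)) := ⟨_, rfl⟩
  have hCc : IsCompact C := by
    rw [hC]
    exact (isCompact_univ_pi fun _ => isCompact_integralFiniteAdeles K).prod
      (isCompact_univ_pi fun _ => isCompact_integralFiniteAdeles K)
  have hGC : ∀ V, G V ∈ C := fun V => by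
    rw [hG, hC, he]
    exact ⟨(linearEquivTuple_mem_pi_iff a b _).mpr ((mem_adelicOrder_iff a b).mp (hu V)),
      (linearEquivTuple_mem_pi_iff a b _).mpr ((mem_adelicOrder_iff a b).mp (hu' V))⟩
  obtain ⟨q, -, hclq⟩ := hCc (f := 𝓕.map G)
    (Filter.le_principal_iff.mpr (Filter.mem_map.mpr (Filter.univ_mem' fun V => hGC V)))
  -- (4) `û û' = û' û = 1` for `(û, û') = e⁻¹ q`
  have hF : Continuous fun x : (Fin 4 → 𝔸ᶠ) × (Fin 4 → 𝔸ᶠ) =>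
      (e (e.symm x.1 * e.symm x.2), e (e.symm x.2 * e.symm x.1)) := by
    rw [he]
    exact (continuous_linearEquivTuple_comp a b (contCoords_mul a b (contCoords_symm a b continuous_fst)
      (contCoords_symm a b continuous_snd))).prodMk (continuous_linearEquivTuple_comp a b
      (contCoords_mul a b (contCoords_symm a b continuous_snd) (contCoords_symm a b continuous_fst)))
  have hZ : IsClosed {x : (Fin 4 → 𝔸ᶠ) × (Fin 4 → 𝔸ᶠ) |
      e.symm x.1 * e.symm x.2 = 1 ∧ e.symm x.2 * e.symm x.1 = 1} := by
    have h := (isClosed_singleton (x := (e 1, e 1))).preimage hF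
    convert h using 1
    ext x
    simp only [Set.mem_setOf_eq, Set.mem_preimage, Set.mem_singleton_iff, Prod.mk.injEq,
      EmbeddingLike.apply_eq_iff_eq]
  have hGZ : ∀ V, G V ∈ {x : (Fin 4 → 𝔸ᶠ) × (Fin 4 → 𝔸ᶠ) |
      e.symm x.1 * e.symm x.2 = 1 ∧ e.symm x.2 * e.symm x.1 = 1} := fun V => by
    rw [hG]
    simp only [Set.mem_setOf_eq, LinearEquiv.symm_apply_apply, Units.mul_inv, Units.inv_mul, and_self]
  obtain ⟨hûû', hû'û⟩ := isClosed_iff_clusterPt.mp hZ q (hclq.mono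
    (Filter.le_principal_iff.mpr (Filter.mem_map.mpr (Filter.univ_mem' fun V => hGZ V))))
  -- (5) `c A c' ∈ 𝓐` for `c = t₀ û`, `c' = û' t₀⁻¹`
  obtain ⟨c, hc⟩ : ∃ c : ℍ⟮𝔸ᶠ; 𝓞 K; a, b⟯, c = (t₀ : ℍ⟮𝔸ᶠ; 𝓞 K; a, b⟯) * e.symm q.1 := ⟨_, rfl⟩
  obtain ⟨c', hc'⟩ : ∃ c' : ℍ⟮𝔸ᶠ; 𝓞 K; a, b⟯, c' = e.symm q.2 * ((t₀⁻¹ : (ℍ⟮𝔸ᶠ; 𝓞 K; a, b⟯)ˣ) : ℍ⟮𝔸ᶠ; 𝓞 K; a, b⟯) := ⟨_, rfl⟩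
  have hcc' : c * c' = 1 := by
    rw [hc, hc']
    calc (t₀ : ℍ⟮𝔸ᶠ; 𝓞 K; a, b⟯) * e.symm q.1 * (e.symm q.2 * ((t₀⁻¹ : (ℍ⟮𝔸ᶠ; 𝓞 K; a, b⟯)ˣ) : ℍ⟮𝔸ᶠ; 𝓞 K; a, b⟯)) =
        (t₀ : ℍ⟮𝔸ᶠ; 𝓞 K; a, b⟯) * (e.symm q.1 * e.symm q.2) * ((t₀⁻¹ : (ℍ⟮𝔸ᶠ; 𝓞 K; a, b⟯)ˣ) : ℍ⟮𝔸ᶠ; 𝓞 K; a, b⟯) := by simp only [mul_assoc]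
      _ = 1 := by rw [hûû', mul_one, Units.mul_inv]
  have hc'c : c' * c = 1 := by
    rw [hc, hc']
    calc e.symm q.2 * ((t₀⁻¹ : (ℍ⟮𝔸ᶠ; 𝓞 K; a, b⟯)ˣ) : ℍ⟮𝔸ᶠ; 𝓞 K; a, b⟯) * ((t₀ : ℍ⟮𝔸ᶠ; 𝓞 K; a, b⟯) * e.symm q.1) =
        e.symm q.2 * (((t₀⁻¹ : (ℍ⟮𝔸ᶠ; 𝓞 K; a, b⟯)ˣ) : ℍ⟮𝔸ᶠ; 𝓞 K; a, b⟯) * (t₀ : ℍ⟮𝔸ᶠ; 𝓞 K; a, b⟯)) * e.symm q.1 := by simp only [mul_assoc]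
      _ = 1 := by rw [Units.inv_mul, mul_one, hû'û]
  have hzz : c * A * c' ∈ approximable a b := by
    intro W hW h0W
    obtain ⟨Ψ, hΨ⟩ : ∃ Ψ : ((Fin 4 → 𝔸ᶠ) × (Fin 4 → 𝔸ᶠ)) × (Fin 4 → 𝔸ᶠ) → ℍ⟮𝔸ᶠ; 𝓞 K; a, b⟯,
        Ψ = fun x => (t₀ : ℍ⟮𝔸ᶠ; 𝓞 K; a, b⟯) * e.symm x.1.1 * (A + e.symm x.2) * e.symm x.1.2 *
          ((t₀⁻¹ : (ℍ⟮𝔸ᶠ; 𝓞 K; a, b⟯)ˣ) : ℍ⟮𝔸ᶠ; 𝓞 K; a, b⟯) := ⟨_, rfl⟩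
    have hΨc : (Continuous fun x => (Ψ x - c * A * c').re) ∧
        (Continuous fun x => (Ψ x - c * A * c').imI) ∧
        (Continuous fun x => (Ψ x - c * A * c').imJ) ∧
        (Continuous fun x => (Ψ x - c * A * c').imK) := by
      rw [hΨ, he]
      exact contCoords_sub a b (contCoords_mul a b (contCoords_mul a b (contCoords_mul a b
        (contCoords_mul a b (contCoords_const a b _)
          (contCoords_symm a b (continuous_fst.comp continuous_fst)))
        (contCoords_add a b (contCoords_const a b A) (contCoords_symm a b continuous_snd)))
        (contCoords_symm a b (continuous_snd.comp continuous_fst))) (contCoords_const a b _))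
        (contCoords_const a b _)
    have hS : IsOpen {x | Ψ x - c * A * c' ∈ coordBox a b W} := isOpen_setOf_mem_coordBox a b hΨc hW
    have hx₀ : (q, (0 : Fin 4 → 𝔸ᶠ)) ∈ {x | Ψ x - c * A * c' ∈ coordBox a b W} := by
      simp only [Set.mem_setOf_eq, hΨ, map_zero, add_zero, hc, hc']
      have e0 : (t₀ : ℍ⟮𝔸ᶠ; 𝓞 K; a, b⟯) * e.symm q.1 * A * e.symm q.2 * ((t₀⁻¹ : (ℍ⟮𝔸ᶠ; 𝓞 K; a, b⟯)ˣ) : ℍ⟮𝔸ᶠ; 𝓞 K; a, b⟯) -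
          (t₀ : ℍ⟮𝔸ᶠ; 𝓞 K; a, b⟯) * e.symm q.1 * A * (e.symm q.2 * ((t₀⁻¹ : (ℍ⟮𝔸ᶠ; 𝓞 K; a, b⟯)ˣ) : ℍ⟮𝔸ᶠ; 𝓞 K; a, b⟯)) = 0 := by
        simp only [mul_assoc, sub_self]
      rw [e0]
      exact zero_mem_coordBox a b h0W
    obtain ⟨N, hN, M, hM, hNM⟩ := mem_nhds_prod_iff.mp (hS.mem_nhds hx₀)
    obtain ⟨W', hW', h0', hW'M⟩ := exists_open_forall_tuple_mem a b hM
    -- a good index `V`: `t V = t₀`, `G V ∈ N`, `V ⊆ W'`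
    obtain ⟨V₁, hV₁⟩ : ∃ V₁ : OpenNhdsOf (0 : 𝔸ᶠ), V₁ = ⟨⟨W', hW'⟩, h0'⟩ := ⟨_, rfl⟩
    have hE : {V : OpenNhdsOf (0 : 𝔸ᶠ) | V ≤ V₁ ∧ t V = t₀} ∈ 𝓕 := by
      rw [h𝓕]
      exact Filter.inter_mem (Filter.mem_inf_of_left (Filter.Iic_mem_atBot V₁))
        (Filter.mem_inf_of_right (Filter.mem_principal_self _))
    obtain ⟨x, hxN, V, ⟨hVle, hVt⟩, hVx⟩ :=
      (clusterPt_iff_nonempty.mp hclq) hN (Filter.image_mem_map hE)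
    refine ⟨y' V, hy' V, ?_⟩
    have hVW' : (V : Set 𝔸ᶠ) ⊆ W' := by
      have h1 : (V : Set 𝔸ᶠ) ⊆ (V₁ : Set 𝔸ᶠ) := SetLike.coe_subset_coe.mpr hVle
      rw [hV₁] at h1
      exact h1
    have hd : z V - A ∈ coordBox a b W' := coordBox_mono a b hVW' (hz V)
    have hmem : (G V, e (z V - A)) ∈ N ×ˢ M := ⟨hVx ▸ hxN, by rw [he]; exact hW'M _ hd⟩
    have key := hNM hmem
    simp only [Set.mem_setOf_eq, hΨ, hG, LinearEquiv.symm_apply_apply, add_sub_cancel] at key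
    rw [hι V, hVt]
    have e2 : (t₀ : ℍ⟮𝔸ᶠ; 𝓞 K; a, b⟯) * (u V : ℍ⟮𝔸ᶠ; 𝓞 K; a, b⟯) * z V * ((((u V)⁻¹ : (ℍ⟮𝔸ᶠ; 𝓞 K; a, b⟯)ˣ)) * ((t₀⁻¹ : (ℍ⟮𝔸ᶠ; 𝓞 K; a, b⟯)ˣ) : ℍ⟮𝔸ᶠ; 𝓞 K; a, b⟯)) =
        (t₀ : ℍ⟮𝔸ᶠ; 𝓞 K; a, b⟯) * (u V : ℍ⟮𝔸ᶠ; 𝓞 K; a, b⟯) * z V * (((u V)⁻¹ : (ℍ⟮𝔸ᶠ; 𝓞 K; a, b⟯)ˣ)) * ((t₀⁻¹ : (ℍ⟮𝔸ᶠ; 𝓞 K; a, b⟯)ˣ) : ℍ⟮𝔸ᶠ; 𝓞 K; a, b⟯) := by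
      simp only [mul_assoc]
    rw [e2]
    exact key
  -- (6) conjugate back by global elements close to `c⁻¹` at `w₀`; `𝓐` is closed
  refine mem_approximable_of_forall_exists a b fun V hV h0 => ?_
  obtain ⟨𝔫, h𝔫0, hbox⟩ :=
    FiniteAdeleRing.exists_forall_valued_le_idealRadius_imp_mem K (hV.mem_nhds h0)
  obtain ⟨ρ, hρ0, hρ⟩ := exists_forall_conj_near_of_near_inv (localComp a b w₀ c)
    (localComp a b w₀ c') g (by rw [← localComp_mul, hcc', localComp_one])
    (by rw [← localComp_mul, hc'c, localComp_one]) (WithZero.exp_ne_zero : idealRadius K w₀ 𝔫 ≠ 0)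
  obtain ⟨k₀, hk₀⟩ := exists_valued_algebraMap_sub_le w₀ (localComp a b w₀ c').re hρ0
  obtain ⟨k₁, hk₁⟩ := exists_valued_algebraMap_sub_le w₀ (localComp a b w₀ c').imI hρ0
  obtain ⟨k₂, hk₂⟩ := exists_valued_algebraMap_sub_le w₀ (localComp a b w₀ c').imJ hρ0
  obtain ⟨k₃, hk₃⟩ := exists_valued_algebraMap_sub_le w₀ (localComp a b w₀ c').imK hρ0
  obtain ⟨β, hβ⟩ : ∃ β : ℍ⟮K; 𝓞 K; a, b⟯, β = ⟨k₀, k₁, k₂, k₃⟩ := ⟨_, rfl⟩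
  have hβw : toAdicCompletion a b w₀ β = ⟨algebraMap K (K_ w₀) k₀, algebraMap K (K_ w₀) k₁,
      algebraMap K (K_ w₀) k₂, algebraMap K (K_ w₀) k₃⟩ := by rw [hβ, toAdicCompletion_apply]
  obtain ⟨u₀, hu₀, hb₀, hb₁, hb₂, hb₃⟩ := hρ (toAdicCompletion a b w₀ β)
    (by rw [hβw, _root_.QuaternionAlgebra.re_sub]; exact hk₀)
    (by rw [hβw, _root_.QuaternionAlgebra.imI_sub]; exact hk₁)
    (by rw [hβw, _root_.QuaternionAlgebra.imJ_sub]; exact hk₂)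
    (by rw [hβw, _root_.QuaternionAlgebra.imK_sub]; exact hk₃)
  -- `β` is a unit of `ℍ[K,a,b]`
  have hβn : β.re ^ 2 - algebraMap (𝓞 K) K a * β.imI ^ 2 - algebraMap (𝓞 K) K b * β.imJ ^ 2 +
      algebraMap (𝓞 K) K a * algebraMap (𝓞 K) K b * β.imK ^ 2 ≠ 0 := by
    have h := normForm_ne_zero_of_mul_eq_one u₀.mul_inv
    rw [hu₀, normForm_toAdicCompletion] at h
    exact fun h0 => h (by rw [h0, map_zero])
  obtain ⟨βu, hβu⟩ : ∃ βu : (ℍ⟮K; 𝓞 K; a, b⟯)ˣ, (βu : ℍ⟮K; 𝓞 K; a, b⟯) = β := ⟨(isUnit_of_normForm_ne_zero β hβn).unit,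
    IsUnit.unit_spec _⟩
  refine ⟨_, conj_mem_approximable a b βu hzz, ?_⟩
  refine mem_coordBox_of_forall_localComp a b hbox fun w => ?_
  have hββ' : toAdicCompletion a b w (βu : ℍ⟮K; 𝓞 K; a, b⟯) * toAdicCompletion a b w ((βu⁻¹ : (ℍ⟮K; 𝓞 K; a, b⟯)ˣ) : ℍ⟮K; 𝓞 K; a, b⟯) = 1 := by
    rw [← map_mul, Units.mul_inv, map_one]
  rw [localComp_sub, localComp_mul, localComp_mul, val_unitsMap_toFiniteAdele,
    val_inv_unitsMap_toFiniteAdele, localComp_toFiniteAdele, localComp_toFiniteAdele, localComp_mul,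
    localComp_mul]
  by_cases hw : w = w₀
  · subst hw
    have e1 : toAdicCompletion a b w (βu : ℍ⟮K; 𝓞 K; a, b⟯) = (u₀ : _) := by rw [hβu]; exact hu₀.symm
    have e2 : toAdicCompletion a b w ((βu⁻¹ : (ℍ⟮K; 𝓞 K; a, b⟯)ˣ) : ℍ⟮K; 𝓞 K; a, b⟯) = ((u₀⁻¹ : _) : _) := by
      rw [e1] at hββ'
      exact (Units.inv_eq_of_mul_eq_one_right hββ').symm
    rw [e1, e2, hAw₀]
    have e3 : (u₀ : _) * (localComp a b w c * g * localComp a b w c') * ((u₀⁻¹ : _) : _) - g =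
        (u₀ : _) * localComp a b w c * g * localComp a b w c' * ((u₀⁻¹ : _) : _) - g := by
      simp only [mul_assoc]
    rw [e3]
    exact ⟨hb₀, hb₁, hb₂, hb₃⟩
  · rw [hAw w hw, mul_one, ← localComp_mul, hcc', localComp_one, mul_one, hββ', sub_self]
    simp only [_root_.QuaternionAlgebra.re_zero, _root_.QuaternionAlgebra.imI_zero,
      _root_.QuaternionAlgebra.imJ_zero, _root_.QuaternionAlgebra.imK_zero, map_zero]
    exact ⟨zero_le, zero_le, zero_le, zero_le⟩

end Global

end QuaternionAlgebra

end Literature.NumberTheory.Automorphic
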